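import Literature.Analysis.OperatorTheory.PseudoResolvent
import Mathlib.Analysis.InnerProductSpace.Basic
import HarnessLib

/-!
# Pseudo-resolvents: the large-`|w|` (far-field) expansion `J(w)f = Σ_{j<n} (−1)^j w^{−(j+1)} A^j f + (−1)^n w^{−n} J(w)A^n f`
# with exact remainder, in resolvent-only form

Analysis/OperatorTheory support file (no definition, no named fact; everything proved). For the resolvent
`J(w) = (A + w)⁻¹` of an operator `A` (Mathlib/Kato sign convention of `Literature.Analysis.OperatorTheory.IsPseudoResolvent`:
`J(z) − J(w) = (w − z)J(z)J(w)`) and `f` in the domain of `A^n`, iterating `J(w)f = w⁻¹f − w⁻¹J(w)(Af)` gives Kato's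
expansion of the resolvent at infinity with an exact remainder,
  `J(w)f = Σ_{j<n} (−1)^j w^{−(j+1)} A^j f + (−1)^n w^{−n} J(w)(A^n f)`.
We state it for a PSEUDO-RESOLVENT, where the unbounded `A` is not available as an object: «`f` lies in the domain and
`Af = g`» is encoded resolvent-only as `f = J(z)(g + z f)` at some (any) `z ∈ U` (for `J = (A + ·)⁻¹` this is
`(A + z)f = g + z f`), and a chain `f₀, f₁, …, f_n` with `f_j = J(z)(f_{j+1} + z f_j)` plays the role of `f_j = A^j f₀`:

* `apply_eq_inv_smul_sub` — one step: `J(w)f = w⁻¹f − w⁻¹J(w)g` for `f = J(z)(g + z f)`, `w ≠ 0`;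
* `apply_eq_sum_add_farField` — the order-`n` expansion above (any `n`, any `w ∈ U ∖ {0}`);
* `inner_apply_eq_sum_add_farField`, `norm_inner_apply_sub_sum_le_farField[_of_bound]` — the scalar form for
  `k(w) = ⟪h, J(w)f₀⟫` with remainder `≤ |w|^{−n}‖h‖‖J(w)f_n‖ ≤ |w|^{−n}‖h‖‖f_n‖/c` under an a priori bound `‖J(w)g‖ ≤ ‖g‖/c`.

MOTIVATION (cell ns-blowup, zone Z3, case Z3-SR-SPEC, paper item (P7), first half): the far field of the Evans function
`k(σ) = θ⟨h, (A_F + σJ)⁻¹Jh⟩_w = θ[‖h‖²σ⁻¹ − ⟨h, a₁⟩σ⁻² + ⟨h, a₂⟩σ⁻³] − θσ⁻³⟨h, (A_F + σJ)⁻¹J a₃⟩`, `a_{j+1} = J⁻¹A_F a_j`,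
is the case `n = 3`, `f_j = a_j`, with `c = c_w(σ)`. [cite: Kato1966, III-§6.1 and I-§5.2 (5.5)] WHAT THIS IS NOT: not Navier–Stokes.
-/

namespace Literature.Analysis.OperatorTheory
namespace IsPseudoResolvent

open scoped InnerProductSpace

section Operator

variable {E : Type*} [NormedAddCommGroup E] [NormedSpace ℂ E]
variable {U : Set ℂ} {J : ℂ → E →L[ℂ] E}

/-- **One step of the expansion at infinity**: if `f = J(z)(g + z f)` («`f ∈ D(A)`, `Af = g`» in resolvent-only form) then
for every `w ∈ U`, `w ≠ 0`: `J(w)f = w⁻¹f − w⁻¹J(w)g` (i.e. `J(w)f = w⁻¹(f − J(w)Af)`).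
[cite: Kato1966, I-§5.2 (5.5)] -/
theorem apply_eq_inv_smul_sub (hJ : IsPseudoResolvent U J) {z w : ℂ} (hz : z ∈ U) (hw : w ∈ U) (hw0 : w ≠ 0)
    {f g : E} (hf : f = J z (g + z • f)) : J w f = w⁻¹ • f - w⁻¹ • J w g := by
  -- resolvent identity applied to `v = g + z f`: `J z v − J w v = (w − z) J z (J w v)`, and `J z, J w` commute
  have E1 := congrArg (fun S : E →L[ℂ] E => S (g + z • f)) (hJ hz hw)
  have hc := congrArg (fun S : E →L[ℂ] E => S (g + z • f)) (hJ.comm hz hw)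
  simp only [sub_apply, smul_apply, mul_apply_eq_comp] at E1 hc
  rw [hc, ← hf, map_add, map_smul] at E1
  -- E1 : f - (J w g + z • J w f) = (w - z) • J w f
  have key : w • J w f = f - J w g := by
    calc w • J w f = (w - z) • J w f + z • J w f := by rw [sub_smul]; abel
      _ = (f - (J w g + z • J w f)) + z • J w f := by rw [E1]
      _ = f - J w g := by abel
  calc J w f = w⁻¹ • (w • J w f) := by rw [smul_smul, inv_mul_cancel₀ hw0, one_smul]
    _ = w⁻¹ • (f - J w g) := by rw [key]
    _ = w⁻¹ • f - w⁻¹ • J w g := smul_sub _ _ _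

/-- **Far-field expansion with exact remainder.** Let `f₀, …, f_n ∈ E` satisfy `f_j = J(z)(f_{j+1} + z f_j)` for `j < n`
(«`f_{j+1} = A f_j`»). Then for every `w ∈ U`, `w ≠ 0`:
`J(w)f₀ = Σ_{j<n} (−1)^j w^{−(j+1)} f_j + (−1)^n w^{−n} J(w)f_n`. [cite: Kato1966, III-§6.1 and I-§5.2 (5.5)] -/
theorem apply_eq_sum_add_farField (hJ : IsPseudoResolvent U J) {z w : ℂ} (hz : z ∈ U) (hw : w ∈ U) (hw0 : w ≠ 0)
    {n : ℕ} {f : ℕ → E} (hchain : ∀ j < n, f j = J z (f (j + 1) + z • f j)) :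
    J w (f 0) = (∑ j ∈ Finset.range n, ((-1) ^ j * w⁻¹ ^ (j + 1)) • f j) + ((-1) ^ n * w⁻¹ ^ n) • J w (f n) := by
  induction n with
  | zero => simp
  | succ n ih =>
    have ih' := ih fun j hj => hchain j (Nat.lt_succ_of_lt hj)
    have hstep := hJ.apply_eq_inv_smul_sub hz hw hw0 (hchain n (Nat.lt_succ_self n))
    rw [ih', hstep, Finset.sum_range_succ, smul_sub, smul_smul, smul_smul, add_assoc, sub_eq_add_neg, ← neg_smul,
      show (-1 : ℂ) ^ n * w⁻¹ ^ n * w⁻¹ = (-1) ^ n * w⁻¹ ^ (n + 1) by ring,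
      show -((-1 : ℂ) ^ n * w⁻¹ ^ (n + 1)) = (-1) ^ (n + 1) * w⁻¹ ^ (n + 1) by ring]

end Operator

section Hilbert

variable {E : Type*} [NormedAddCommGroup E] [InnerProductSpace ℂ E]
variable {U : Set ℂ} {J : ℂ → E →L[ℂ] E}

/-- **Scalar far-field expansion**: under the chain hypothesis of `apply_eq_sum_add_farField`,
`⟪h, J(w)f₀⟫ = Σ_{j<n} (−1)^j w^{−(j+1)}⟪h, f_j⟫ + (−1)^n w^{−n}⟪h, J(w)f_n⟫`. [cite: Kato1966, III-§6.1 and I-§5.2 (5.5)] -/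
theorem inner_apply_eq_sum_add_farField (hJ : IsPseudoResolvent U J) {z w : ℂ} (hz : z ∈ U) (hw : w ∈ U)
    (hw0 : w ≠ 0) {n : ℕ} {f : ℕ → E} (hchain : ∀ j < n, f j = J z (f (j + 1) + z • f j)) (h : E) :
    ⟪h, J w (f 0)⟫_ℂ = (∑ j ∈ Finset.range n, ((-1) ^ j * w⁻¹ ^ (j + 1)) * ⟪h, f j⟫_ℂ)
      + ((-1) ^ n * w⁻¹ ^ n) * ⟪h, J w (f n)⟫_ℂ := by
  rw [hJ.apply_eq_sum_add_farField hz hw hw0 hchain, inner_add_right, inner_sum, inner_smul_right]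
  simp only [inner_smul_right]

/-- **Far-field remainder bound**: `‖⟪h, J(w)f₀⟫ − Σ_{j<n} (−1)^j w^{−(j+1)}⟪h, f_j⟫‖ ≤ |w|^{−n}‖h‖‖J(w)f_n‖`.
[cite: Kato1966, III-§6.1 and I-§5.2 (5.5)] -/
theorem norm_inner_apply_sub_sum_le_farField (hJ : IsPseudoResolvent U J) {z w : ℂ} (hz : z ∈ U) (hw : w ∈ U)
    (hw0 : w ≠ 0) {n : ℕ} {f : ℕ → E} (hchain : ∀ j < n, f j = J z (f (j + 1) + z • f j)) (h : E) :
    ‖⟪h, J w (f 0)⟫_ℂ - ∑ j ∈ Finset.range n, ((-1) ^ j * w⁻¹ ^ (j + 1)) * ⟪h, f j⟫_ℂ‖ ≤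
      ‖w‖⁻¹ ^ n * ‖h‖ * ‖J w (f n)‖ := by
  rw [hJ.inner_apply_eq_sum_add_farField hz hw hw0 hchain h, add_sub_cancel_left, norm_mul, norm_mul, norm_pow,
    norm_pow, norm_neg, norm_one, one_pow, one_mul, norm_inv, mul_assoc]
  exact mul_le_mul_of_nonneg_left (norm_inner_le_norm _ _) (by positivity)

/-- **Far-field remainder with an a priori resolvent estimate**: if moreover `‖J(w)g‖ ≤ ‖g‖/c` for all `g`, the
remainder is `≤ |w|^{−n}‖h‖‖f_n‖/c` — the form `θ‖h‖‖a₃‖/(c_w|σ|³)` of an Evans-function far-field certificate (`n = 3`).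
[cite: Kato1966, III-§6.1 and I-§5.2 (5.5)] -/
theorem norm_inner_apply_sub_sum_le_farField_of_bound (hJ : IsPseudoResolvent U J) {z w : ℂ} (hz : z ∈ U)
    (hw : w ∈ U) (hw0 : w ≠ 0) {n : ℕ} {f : ℕ → E} (hchain : ∀ j < n, f j = J z (f (j + 1) + z • f j)) (h : E)
    {c : ℝ} (hb : ∀ g : E, ‖J w g‖ ≤ ‖g‖ / c) :
    ‖⟪h, J w (f 0)⟫_ℂ - ∑ j ∈ Finset.range n, ((-1) ^ j * w⁻¹ ^ (j + 1)) * ⟪h, f j⟫_ℂ‖ ≤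
      ‖w‖⁻¹ ^ n * ‖h‖ * ‖f n‖ / c := by
  refine (hJ.norm_inner_apply_sub_sum_le_farField hz hw hw0 hchain h).trans ?_
  rw [mul_div_assoc]
  exact mul_le_mul_of_nonneg_left (hb (f n)) (by positivity)

end Hilbert

end IsPseudoResolvent
end Literature.Analysis.OperatorTheory
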